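import Literature.Topology.FourManifolds.ThetaFourKervaireMilnor
import Literature.Topology.FourManifolds.HomotopySpheresSignatureKilling
import Literature.Topology.FourManifolds.HomotopySpheresSignatureProofs
import Literature.Topology.FourManifolds.SphereSurgeryStep
import Literature.GroupTheory.FiniteAbelian.RankTorsionKilling
import Literature.AlgebraicTopology.SingularHomology.SimplyConnectedH1
import Literature.AlgebraicTopology.SingularHomology.BoundaryManifoldFiniteness
import HarnessLib

/-!
# `Θ₄ = 0` along Kervaire–Milnor's proof, II: Theorem 5.1 at `k = 2` reduced along its printed
# proof — §5's book-keeping proved, Thm. 5.5 and Lemmas 5.3–5.4, 5.6, 5.8 as hypotheses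

Topic `Literature/Topology/FourManifolds`; second proofs file of `ThetaFourKervaireMilnor.lean`
(next to `ThetaFourKervaireMilnorProofs.lean`, the `Θ₄ = 0` chain over its frontier), written for
the D-0026 review (2026-08-15) of the decomposition child
`Literature.Topology.FourManifolds.HomotopySphere.boundsContractible_of_nullCobordism_isStablyParallelizable_four`
— M. Kervaire, J. Milnor, *Groups of homotopy spheres I*, Ann. of Math. (2) 77 (1963), **Thm. 5.1**
(p. 512: "If a homotopy sphere of dimension `2k` bounds an s-parallelizable manifold `M`, then it
bounds a contractible manifold `M₁`") at `k = 2`, i.e. `bP₅ = 0`, one of the unproved leaves of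
`Θ₄ = 0`. Everything in this file is **proved**; no definition and no named fact is introduced, and
no statement of the tree is modified.

## Review of the child (with the source open)

The child is Thm. 5.1 as printed, specialised to `k = 2` (the instance `Θ₄ = 0` consumes), in the
tree's unoriented language (`NullCobordism`, `IsStablyParallelizable (𝓡∂ 5)`, `BoundsContractible`;
its docstring records why this reading follows from the oriented one). It is a numbered theorem
with its own locator, not a slice of a proof, and it has the shape of the inline hypothesis `h51`
(Thm. 5.1 for even `n ≥ 6`) of `HomotopySphereClass.subsingleton_bP_of_boundsContractible`
(`HCobordismThetaFiniteKM.lean`). The printed proof covers `k = 2`: "The proof for `k > 1` will be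
based on the technique of spherical modifications" (p. 513); Thm. 5.5 needs `n ≥ 2k` (`5 ≥ 4`),
Lemma 5.3 needs `p < n/2` (`2 < 5/2`), Lemma 5.4 needs `n ≥ 2p + 1` (`5 ≥ 5`), the standing
Hypothesis of p. 516 is `k > 1`, and the "Proof of Theorem 5.1 for `k` even" (pp. 518–519) is
uniform in even `k`. (The remark "our methods break down completely for the case `k = 2`", p. 527,
concerns Lemma 7.1 — manifolds of dimension `2k = 4` — not Thm. 5.1.) So the child is correctly
cut and faithful; it is not restated. It is also genuinely `XL` relative to the tree: its proof is
§5 — framed spherical modifications of a `5`-manifold keeping s-parallelizability (Thm. 5.5,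
Lemmas 5.2–5.4; in the tree only as the hypotheses `h_simply`, `h21` of
`HomotopySphere.exists_highlyConnected_of_mem_signatureSet_of`, `SurgeryBelowMiddleDimension.lean`)
and the middle-dimensional homology of a modification (Lemma 5.6: excision and intersection
numbers; Lemma 5.7: Poincaré duality; Lemmas 5.8–5.9: the semi-characteristic of the trace) — none
of which is in Mathlib or in the tree.

## The printed proof (pp. 513–519) at `k = 2`, and what is proved here

For `Σ⁴ = bW`, `W` compact and s-parallelizable: (0) pass to the component of `W` containing `bW`
(Thm. 6.6, proof: "provided that `M` is connected"; the tree's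
`NullCobordism.exists_connectedSpace_isStablyParallelizable`, PROVED); (1) **Thm. 5.5** (p. 514):
by spherical modifications `W` becomes simply connected (`(k-1)`-connected), still
s-parallelizable, `bW₁ = bW`; from now on `M = W` satisfies the **Hypothesis** of p. 516 (compact,
s-parallelizable, dimension `2k + 1 = 5`, `(k-1)`-connected, `bM` a homology sphere), and so does
every modification `χ(M, φ)` along a framed `2`-sphere `φ` chosen by Lemma 5.4 (s-parallelizable
again; simply connected again, p. 516 — in the tree `FramedSphereFamily.simplyConnectedSpace_surgered`,
PROVED; `bχ = bM`, p. 513 — in the tree `NullCobordism.surgery`); (2) **Lemmas 5.3, 5.4** (pp.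
513–514, with Hurewicz, p. 514: "`π_kM` may be replaced by `H_kM`"): every `λ ∈ H₂M` is the class of
a framed imbedded `2`-sphere `φ` with `χ(M, φ)` s-parallelizable; **Lemma 5.6** (p. 514): for
`M' = χ(M, φ)`, "`H_kM/λ(Z)` is isomorphic to `H_kM'/λ'(Z)`"; its **Assertion** (p. 516) with the
duality sentence of the proof of **Lemma 5.7** (p. 516: "Let `λ` generate one of the infinite
cyclic summands. Using the Poincaré duality theorem … `λ` is primitive, and can be killed by a
modification"): if `λ` generates an infinite cyclic direct summand then `H_kM' ≅ H_kM/λ(Z)`;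
**Lemma 5.8** (p. 516): "If `k` is even then the modification `χ(φ)` necessarily changes the `k`ᵗʰ
Betti number of `M`"; (3) **Lemma 5.7** (induction on the rank) and the **"Proof of Theorem 5.1
for `k` even"** (pp. 518–519, induction on the order of the torsion group) — pure algebra of
finitely generated abelian groups over the black boxes of (2), PROVED in
`Literature/GroupTheory/FiniteAbelian/RankTorsionKilling.lean`
(`exists_addEquiv_torsion_of_killFree`, `exists_subsingleton_of_torsionStep_of_rankStep`); (4)
p. 514: "It will then follow from the Poincaré duality theorem that `M₁` is contractible" — the
tree's `HomotopySphere.boundsContractible_of_isZero_singularHomology_le` (Thm. 6.6, last clause;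
`HomotopySpheresSignatureKilling.lean`, PROVED), with `H₁(M₁) = 0`
(`isZero_singularHomology_one_of_simplyConnectedSpace`) and the finite generation of `H₂(W; ℤ)`
(`finite_singularHomology_of_compact_chartedSpace_halfSpace`, Hatcher Cor. A.8–A.9).

* `HomotopySphere.boundsContractible_of_nullCobordism_isStablyParallelizable_four_of_surgeryLemmas`
  — **the child GIVEN exactly the geometric statements of (1)–(2)** as inline hypotheses about the
  tree's surgery `c.surgery ν` along a framed `2`-sphere `ν : FramedSphereFamily (𝓡∂ 5) W Unit 2 3`
  (plain binders; nothing is asserted, no named fact is introduced): `h55` (Thm. 5.5), `h534`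
  (Lemmas 5.3–5.4 with Hurewicz), `h56` (Lemma 5.6), `hkill` (Assertion p. 516 with the duality
  step of Lemma 5.7), `h58` (Lemma 5.8); steps (0), (3), (4) are theorems.
* `HomotopySphere.boundsContractible_of_nullCobordism_isStablyParallelizable_four_of_killHomology`
  — the child GIVEN only the surgical clause of **Thm. 6.6** (p. 526: "By a sequence of framed
  modifications, `M` can be reduced to a `k`-connected manifold `M₁`") at `k = 2`, in the shape of
  the hypothesis `hkill` of `HomotopySphere.lemma73_of_killMiddleHomology`; the coarsest faithful
  cut (steps (0)–(3) together), for the record.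

So the frontier of `boundsContractible_of_nullCobordism_isStablyParallelizable_four_holds` is
exactly `h55`, `h534`, `h56`, `hkill`, `h58` below — framed surgery on `5`-manifolds and the
homology of one modification (§5) — shared with the hypotheses `h_simply`/`h21`
(`SurgeryBelowMiddleDimension.lean`), `hkill` (`HomotopySpheresSignatureKilling.lean`) and `h51`
(`HCobordismThetaFiniteKM.lean`) of the tree. Conventions: `H₂(W) = H₂(W; ℤ)` is
`singularHomology ℤ ℤ W 2`, "`≅`" is an isomorphism of abelian groups `≃+`, `λ(Z)` is
`AddSubgroup.zmultiples λ`, the Betti number is `Module.finrank ℤ`, the class `λ` of the core of `ν`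
is `(ν.sphereMap)_* θ` for a generator `θ` of `H₂(S²; ℤ)`.

## References

* M. Kervaire, J. Milnor, *Groups of homotopy spheres I*, Ann. of Math. (2) 77 (1963), 504–537:
  Thm. 5.1 (p. 512), p. 513, Lemmas 5.2–5.4 and Thm. 5.5 (pp. 513–514), p. 514 (duality),
  Lemma 5.6 (pp. 514–516), Hypothesis, Assertion and Lemma 5.7 (p. 516), Lemma 5.8 (pp. 516–518),
  "Proof of Theorem 5.1 for `k` even" (pp. 518–519), Thm. 6.6 (p. 526), remark p. 527.
  doi:10.2307/1970128 [KervaireMilnorAnnals1963]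
* A. Hatcher, *Algebraic Topology*, CUP (2002), Cor. A.8–A.9 (finite generation). [HatcherAT2002]
-/

noncomputable section

open scoped Manifold ContDiff Topology
open Set Function CategoryTheory CategoryTheory.Limits AddSubgroup
open Literature.AlgebraicTopology.SingularHomology Literature.GroupTheory.FiniteAbelian

namespace Literature.Topology.FourManifolds

namespace HomotopySphere

/-! ### Theorem 5.1 at `k = 2` from Thm. 5.5 and Lemmas 5.3–5.4, 5.6, 5.8 -/

/-- **Kervaire–Milnor's Thm. 5.1 at `k = 2` along its printed proof (§5).** The named fact
`boundsContractible_of_nullCobordism_isStablyParallelizable_four` (every homotopy `4`-sphere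
bounding a compact s-parallelizable `5`-manifold bounds a contractible one) GIVEN, as inline
hypotheses about null-cobordisms `W` (`c`, `bW = Σ`) of the homotopy `4`-sphere `Σ` in question
and the tree's surgery `χ(W, φ) = c.surgery ν _` along a framed imbedded `2`-sphere
`φ = ν : FramedSphereFamily (𝓡∂ 5) W Unit 2 3` (`S² × D³ ↪ W`, again a null-cobordism of `Σ`):
* `h55` — **Thm. 5.5** (p. 514) at `n = 5`, `k = 2`: "Let `M` be a compact, connected
  s-parallelizable manifold of dimension `n ≥ 2k`. By a sequence of spherical modifications on `M`
  one can obtain an s-parallelizable manifold `M₁` which is `(k-1)`-connected. Recall that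
  `bM₁ = bM`";
* `h534` — **Lemmas 5.3 and 5.4** (pp. 513–514; `p = 2 < 5/2`, `n = 5 ≥ 2p + 1`), read on `H₂`
  through the Hurewicz theorem (p. 514: "`π_kM` may be replaced by the homology group `H_kM`"),
  for `W` simply connected and s-parallelizable: every `λ ∈ H₂(W)` is the class `φ_*[S²]` of a
  framed imbedded `2`-sphere `φ` such that `χ(W, φ)` is again s-parallelizable;
* `h56` — **Lemma 5.6** (pp. 514–516) for such `W`, `φ`: "It follows that the quotient group
  `H_kM/λ(Z)` is isomorphic to `H_kM'/λ'(Z)`";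
* `hkill` — the **Assertion** of p. 516 ("Any primitive element of `H_kM` can be killed by a
  spherical modification": `H_kM' ≅ H_kM/λ(Z)`) combined with the duality step of the proof of
  **Lemma 5.7** (p. 516: if `λ` generates an infinite cyclic direct summand — some `f : H_kM → Z`
  has `f λ = 1` — then by Poincaré duality and `H_k(bM) = 0`, `λ` is primitive): for such `λ`,
  `H₂(χ(W, φ)) ≅ H₂(W)/λ(Z)`;
* `h58` — **Lemma 5.8** (p. 516, `k = 2` even) for such `W` and any framed `2`-sphere: "the
  modification `χ(F)` necessarily changes the `k`ᵗʰ Betti number of `M`" (`Module.finrank ℤ`).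
PROVED around them: the passage to the component of `bW`
(`NullCobordism.exists_connectedSpace_isStablyParallelizable`), that a modification of a simply
connected `W` along a `2`-sphere with cosphere `S²` is simply connected
(`FramedSphereFamily.simplyConnectedSpace_surgered`) — so the Hypothesis of p. 516 is kept —, the
finite generation of `H₂(W; ℤ)`, Lemma 5.7 and the iteration of pp. 518–519
(`exists_addEquiv_torsion_of_killFree`, `exists_subsingleton_of_torsionStep_of_rankStep`,
`RankTorsionKilling.lean`), and the duality conclusion of p. 514
(`boundsContractible_of_isZero_singularHomology_le`). None of the five hypotheses is in Mathlib or
in the tree. [cite: KervaireMilnorAnnals1963, Thm. 5.1 (p. 512) via Thm. 5.5 (p. 514), Lemmas 5.3, 5.4, 5.6, 5.7, 5.8 (pp. 513–518) and pp. 518–519, 514] -/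
theorem boundsContractible_of_nullCobordism_isStablyParallelizable_four_of_surgeryLemmas
    (h55 : ∀ (S : HomotopySphere 4) (c : NullCobordism 4 S.carrier), ConnectedSpace c.W →
      IsStablyParallelizable (𝓡∂ (4 + 1)) c.W →
        ∃ c₁ : NullCobordism 4 S.carrier,
          SimplyConnectedSpace c₁.W ∧ IsStablyParallelizable (𝓡∂ (4 + 1)) c₁.W)
    (h534 : ∀ (S : HomotopySphere 4) (c : NullCobordism 4 S.carrier), SimplyConnectedSpace c.W →
      IsStablyParallelizable (𝓡∂ (4 + 1)) c.W → ∀ x : singularHomology ℤ ℤ c.W 2,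
        ∃ (ν : FramedSphereFamily (𝓡∂ (4 + 1)) c.W Unit 2 (2 + 1))
          (θ : singularHomology ℤ ℤ (Metric.sphere (0 : EuclideanSpace ℝ (Fin (2 + 1))) 1) 2), zmultiples θ = ⊤ ∧
            singularHomology.map ℤ ℤ ν.sphereMap 2 θ = x ∧
            IsStablyParallelizable (𝓡∂ (4 + 1)) (c.surgery ν rfl).W)
    (h56 : ∀ (S : HomotopySphere 4) (c : NullCobordism 4 S.carrier), SimplyConnectedSpace c.W →
      IsStablyParallelizable (𝓡∂ (4 + 1)) c.W →
        ∀ (ν : FramedSphereFamily (𝓡∂ (4 + 1)) c.W Unit 2 (2 + 1))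
          (θ : singularHomology ℤ ℤ (Metric.sphere (0 : EuclideanSpace ℝ (Fin (2 + 1))) 1) 2), zmultiples θ = ⊤ →
          ∃ x' : singularHomology ℤ ℤ (c.surgery ν rfl).W 2,
            Nonempty (singularHomology ℤ ℤ c.W 2 ⧸
                zmultiples (singularHomology.map ℤ ℤ ν.sphereMap 2 θ) ≃+
              singularHomology ℤ ℤ (c.surgery ν rfl).W 2 ⧸ zmultiples x'))
    (hkill : ∀ (S : HomotopySphere 4) (c : NullCobordism 4 S.carrier), SimplyConnectedSpace c.W →
      IsStablyParallelizable (𝓡∂ (4 + 1)) c.W →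
        ∀ (ν : FramedSphereFamily (𝓡∂ (4 + 1)) c.W Unit 2 (2 + 1))
          (θ : singularHomology ℤ ℤ (Metric.sphere (0 : EuclideanSpace ℝ (Fin (2 + 1))) 1) 2), zmultiples θ = ⊤ →
          (∃ f : singularHomology ℤ ℤ c.W 2 →+ ℤ,
              f (singularHomology.map ℤ ℤ ν.sphereMap 2 θ) = 1) →
            Nonempty (singularHomology ℤ ℤ (c.surgery ν rfl).W 2 ≃+
              singularHomology ℤ ℤ c.W 2 ⧸ zmultiples (singularHomology.map ℤ ℤ ν.sphereMap 2 θ)))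
    (h58 : ∀ (S : HomotopySphere 4) (c : NullCobordism 4 S.carrier), SimplyConnectedSpace c.W →
      IsStablyParallelizable (𝓡∂ (4 + 1)) c.W →
        ∀ ν : FramedSphereFamily (𝓡∂ (4 + 1)) c.W Unit 2 (2 + 1),
          Module.finrank ℤ (singularHomology ℤ ℤ (c.surgery ν rfl).W 2) ≠
            Module.finrank ℤ (singularHomology ℤ ℤ c.W 2)) :
    boundsContractible_of_nullCobordism_isStablyParallelizable_four := by
  intro S c hpar
  haveI : ConnectedSpace S.carrier := HomotopySphere.connectedSpace (by norm_num) S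
  -- (0) the component of `bW`
  obtain ⟨c₀, hc₀, hpar₀⟩ := c.exists_connectedSpace_isStablyParallelizable hpar
  -- (1) Thm. 5.5: a simply connected, s-parallelizable `W₁`; the Hypothesis of p. 516
  obtain ⟨c₁, hsc₁, hpar₁⟩ := h55 S c₀ hc₀ hpar₀
  let P : NullCobordism 4 S.carrier → Prop := fun c =>
    SimplyConnectedSpace c.W ∧ IsStablyParallelizable (𝓡∂ (4 + 1)) c.W
  -- a modification along a framed `2`-sphere keeps the Hypothesis (p. 516; Lemma 5.4)
  have hP : ∀ (c : NullCobordism 4 S.carrier), P c →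
      ∀ ν : FramedSphereFamily (𝓡∂ (4 + 1)) c.W Unit 2 (2 + 1),
        IsStablyParallelizable (𝓡∂ (4 + 1)) (c.surgery ν rfl).W → P (c.surgery ν rfl) := by
    intro c hc ν hν
    haveI := hc.1
    exact ⟨FramedSphereFamily.simplyConnectedSpace_surgered ν rfl (by norm_num) le_rfl, hν⟩
  -- `H₂(W; ℤ)` is finitely generated
  have hfin : ∀ c : NullCobordism 4 S.carrier, P c → AddGroup.FG (singularHomology ℤ ℤ c.W 2) := by
    intro c _
    have h := finite_singularHomology_of_compact_chartedSpace_halfSpace ℤ ℤ (n := 4) (W := c.W) 2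
    exact Module.Finite.iff_addGroup_fg.1
      (by convert h using 2 <;> first | rfl | exact Subsingleton.elim _ _)
  -- (2)–(3a) Lemma 5.7: reduction of `H₂` to its torsion subgroup
  have h57 : ∀ c : NullCobordism 4 S.carrier, P c → ∃ c₁ : NullCobordism 4 S.carrier, P c₁ ∧
      Nonempty (singularHomology ℤ ℤ c₁.W 2 ≃+ AddCommGroup.torsion (singularHomology ℤ ℤ c.W 2)) :=
    fun c hc => exists_addEquiv_torsion_of_killFree
      (G := fun c : NullCobordism 4 S.carrier => singularHomology ℤ ℤ c.W 2) P hfin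
      (fun c hc x f hfx => by
        obtain ⟨ν, θ, hθ, hx, hpar'⟩ := h534 S c hc.1 hc.2 x
        subst hx
        obtain ⟨e⟩ := hkill S c hc.1 hc.2 ν θ hθ ⟨f, hfx⟩
        exact ⟨c.surgery ν rfl, hP c hc ν hpar', ⟨e⟩⟩) hc
  -- (2)–(3b) Lemmas 5.6, 5.8 and the iteration of pp. 518–519: `H₂` can be killed
  obtain ⟨c₂, ⟨hsc₂, -⟩, hH₂⟩ :=
    exists_subsingleton_of_torsionStep_of_rankStep
      (G := fun c : NullCobordism 4 S.carrier => singularHomology ℤ ℤ c.W 2) P hfin h57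
      (fun c hc x hx => by
        obtain ⟨ν, θ, hθ, hx', hpar'⟩ := h534 S c hc.1 hc.2 x
        subst hx'
        obtain ⟨y, ⟨e⟩⟩ := h56 S c hc.1 hc.2 ν θ hθ
        exact ⟨c.surgery ν rfl, hP c hc ν hpar', ⟨y, ⟨e⟩⟩,
          by convert h58 S c hc.1 hc.2 ν using 2 <;> exact Subsingleton.elim _ _⟩)
      ⟨hsc₁, hpar₁⟩
  -- (4) "It will then follow from the Poincaré duality theorem that `M₁` is contractible"
  haveI := hsc₂
  refine boundsContractible_of_isZero_singularHomology_le (k := 2) (by norm_num) (by norm_num) S c₂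
    fun i hi hik => ?_
  rcases (show i = 1 ∨ i = 2 by omega) with rfl | rfl
  · exact isZero_singularHomology_one_of_simplyConnectedSpace ℤ ℤ
  · haveI := hH₂
    exact ModuleCat.isZero_of_subsingleton _

/-! ### Theorem 5.1 at `k = 2` from the surgical clause of Theorem 6.6 -/

/-- **Kervaire–Milnor's Thm. 5.1 at `k = 2` from the surgical clause of Thm. 6.6 at `k = 2`.**
The named fact `boundsContractible_of_nullCobordism_isStablyParallelizable_four` GIVEN (`hkill`,
in the shape of the hypothesis of `lemma73_of_killMiddleHomology`) **Thm. 6.6, first clause**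
(p. 526: "Let `M` be a compact, framed manifold of dimension `2k + 1`, `k > 1`, such that `bM` is
either vacuous or a homology sphere. By a sequence of framed modifications, `M` can be reduced to
a `k`-connected manifold `M₁`", with `bM₁ = bM`, p. 513) at `k = 2` for null-cobordisms of homotopy
`4`-spheres: an s-parallelizable `W` with `bW = Σ` may be replaced by a simply connected `W₁` with
`H₁(W₁; ℤ) = H₂(W₁; ℤ) = 0` and `bW₁ = Σ`. The last clause of Thm. 6.6 ("If `bM` is a homology
sphere, then `M₁` is contractible") is the tree theorem
`boundsContractible_of_isZero_singularHomology_le`. This is the coarsest faithful cut of the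
child; `boundsContractible_of_nullCobordism_isStablyParallelizable_four_of_surgeryLemmas` refines
it along §5. [cite: KervaireMilnorAnnals1963, Thm. 6.6 (p. 526) with Thm. 5.1 (p. 512) and p. 514] -/
theorem boundsContractible_of_nullCobordism_isStablyParallelizable_four_of_killHomology
    (hkill : ∀ (S : HomotopySphere 4) (c : NullCobordism 4 S.carrier),
      IsStablyParallelizable (𝓡∂ (4 + 1)) c.W →
        ∃ c₁ : NullCobordism 4 S.carrier, SimplyConnectedSpace c₁.W ∧
          ∀ i : ℕ, 0 < i → i ≤ 2 → Subsingleton (singularHomology ℤ ℤ c₁.W i)) :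
    boundsContractible_of_nullCobordism_isStablyParallelizable_four := by
  intro S c hpar
  obtain ⟨c₁, hsc₁, hH⟩ := hkill S c hpar
  haveI := hsc₁
  exact boundsContractible_of_isZero_singularHomology_le (k := 2) (by norm_num) (by norm_num) S c₁
    fun i hi hik => by
      haveI := hH i hi hik
      exact ModuleCat.isZero_of_subsingleton _

end HomotopySphere

end Literature.Topology.FourManifolds

end
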